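import Literature.NumberTheory.LFunctions.ZetaScrewSeriesProofs
import Literature.NumberTheory.LFunctions.WeilZeroSum
import HarnessLib

/-!
# Route IntegerScrew — the unconditional expansion of the screw form over the zeros of `ζ`

Helper file for crux `IntegerScrew.ScrewPolyFloor` (stmt-RiemannHypothesis-15757). Suzuki's series
`Ψ(t) = ∑_ρ m(ρ)(cosh((ρ−½)t) − 1)/(ρ−½)²` (Suzuki2023 Thm 1.1 (2), PROVED in the tree:
`Suzuki2023_thm11_series_holds`) turns the screw quadratic form of the crux on a BALANCED vector
(`∑_{m ≤ M} y_m = 0`, `y_1 := −∑_{m ≥ 2} y_m`) into a sum over the non-trivial zeros of LANDAU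
CHARACTERS, with no hypothesis on the zeros (`hasSum_screwForm`):

  `∑_{2 ≤ m,m' ≤ M} G(log m, log m') y_m y_m' = ∑_ρ m(ρ) · (−P_y(ρ−½) P_y(½−ρ)) / (ρ−½)²`,
  `P_y(s) = ∑_{1 ≤ m ≤ M} y_m m^s`,

absolutely convergent (`HasSum` over the subtype of non-trivial zeros). Under RH, `ρ − ½ = iγ` and
the summand is `m(ρ)|P_y(iγ)|²/γ² ≥ 0` (the mechanism of `floorOfRH_proof`); unconditionally the
pairing `P_y(ρ−½)P_y(½−ρ)` is the object evaluated by Landau's formula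
(`IntegerScrewScrewPolyFloorLandauPairing.lean`, `…LandauBlock.lean`).

The algebra (`kernel_double_sum`, `dirPoly_eq`, `kernel_double_sum_eq_neg`) is the crux-strategist's
(`Cruxes/ScrewPolyFloor/IntegerScrewFloorOfRH.lean` §B, planner-cstrat-stmt-RiemannHypothesis-15757-b1),
landed here def-free and in `cpow` form.
-/

noncomputable section

open Complex Finset
open scoped Real

-- the layout-mandated namespace repeats the summit name
set_option linter.dupNamespace false

namespace Summit.RiemannHypothesis.RiemannHypothesis.Theorems.IntegerScrewLandau

open Literature.NumberTheory.LFunctions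

/-! ### Finite algebra: the kernel double sum is `−P(s)P(−s)` -/

/-- Core finite identity: with `C = Σ_{2≤a≤M} y_a cosh(s log a)`, `S = Σ y_a sinh(s log a)`,
`c = Σ_{2≤a≤M} y_a`:
`Σ_{a,b} y_a y_b [cosh(sA) + cosh(sB) − cosh(sA − sB) − 1] = 2cC − (C² − S²) − c²`. [folklore] -/
theorem kernel_double_sum (M : ℕ) (y : ℕ → ℝ) (s : ℂ) :
    ∑ a ∈ Icc 2 M, ∑ b ∈ Icc 2 M, ((y a : ℝ) : ℂ) * ((y b : ℝ) : ℂ) *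
        (Complex.cosh (s * (Real.log (a : ℝ) : ℂ)) + Complex.cosh (s * (Real.log (b : ℝ) : ℂ)) -
          Complex.cosh (s * (Real.log (a : ℝ) : ℂ) - s * (Real.log (b : ℝ) : ℂ)) - 1) =
      2 * (∑ a ∈ Icc 2 M, ((y a : ℝ) : ℂ)) *
          (∑ a ∈ Icc 2 M, ((y a : ℝ) : ℂ) * Complex.cosh (s * (Real.log (a : ℝ) : ℂ))) -
        ((∑ a ∈ Icc 2 M, ((y a : ℝ) : ℂ) * Complex.cosh (s * (Real.log (a : ℝ) : ℂ))) ^ 2 -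
          (∑ a ∈ Icc 2 M, ((y a : ℝ) : ℂ) * Complex.sinh (s * (Real.log (a : ℝ) : ℂ))) ^ 2) -
        (∑ a ∈ Icc 2 M, ((y a : ℝ) : ℂ)) ^ 2 := by
  have hsummand : ∀ a b : ℕ,
      ((y a : ℝ) : ℂ) * ((y b : ℝ) : ℂ) *
          (Complex.cosh (s * (Real.log (a : ℝ) : ℂ)) + Complex.cosh (s * (Real.log (b : ℝ) : ℂ)) -
            Complex.cosh (s * (Real.log (a : ℝ) : ℂ) - s * (Real.log (b : ℝ) : ℂ)) - 1) =
        (((y a : ℝ) : ℂ) * Complex.cosh (s * (Real.log (a : ℝ) : ℂ))) * ((y b : ℝ) : ℂ) +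
          ((y a : ℝ) : ℂ) * (((y b : ℝ) : ℂ) * Complex.cosh (s * (Real.log (b : ℝ) : ℂ))) -
          (((y a : ℝ) : ℂ) * Complex.cosh (s * (Real.log (a : ℝ) : ℂ))) *
            (((y b : ℝ) : ℂ) * Complex.cosh (s * (Real.log (b : ℝ) : ℂ))) +
          (((y a : ℝ) : ℂ) * Complex.sinh (s * (Real.log (a : ℝ) : ℂ))) *
            (((y b : ℝ) : ℂ) * Complex.sinh (s * (Real.log (b : ℝ) : ℂ))) -
          ((y a : ℝ) : ℂ) * ((y b : ℝ) : ℂ) := by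
    intro a b
    rw [Complex.cosh_sub]
    ring
  rw [Finset.sum_congr rfl fun a _ => Finset.sum_congr rfl fun b _ => hsummand a b]
  simp only [Finset.sum_add_distrib, Finset.sum_sub_distrib]
  rw [← Finset.sum_mul_sum, ← Finset.sum_mul_sum, ← Finset.sum_mul_sum, ← Finset.sum_mul_sum,
    ← Finset.sum_mul_sum]
  ring

/-- `m^s = e^{s log m}` for `m ≥ 1`. [folklore] -/
theorem natCast_cpow_eq_cexp {m : ℕ} (hm : 1 ≤ m) (s : ℂ) :
    (m : ℂ) ^ s = cexp (s * (Real.log (m : ℝ) : ℂ)) := by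
  have hm0 : (0 : ℝ) < m := by exact_mod_cast hm
  rw [cpow_def_of_ne_zero (by exact_mod_cast hm0.ne'), show (m : ℂ) = ((m : ℝ) : ℂ) by norm_cast,
    ← ofReal_log hm0.le, mul_comm]

/-- The Dirichlet polynomial split at `m = 1`: `P(s) = y_1 + C + S`. [folklore] -/
theorem dirPoly_eq (M : ℕ) (hM : 1 ≤ M) (y : ℕ → ℝ) (s : ℂ) :
    ∑ m ∈ Icc 1 M, ((y m : ℝ) : ℂ) * (m : ℂ) ^ s = ((y 1 : ℝ) : ℂ) +
      ((∑ a ∈ Icc 2 M, ((y a : ℝ) : ℂ) * Complex.cosh (s * (Real.log (a : ℝ) : ℂ))) +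
        ∑ a ∈ Icc 2 M, ((y a : ℝ) : ℂ) * Complex.sinh (s * (Real.log (a : ℝ) : ℂ))) := by
  have hsplit : Finset.Icc 1 M = insert 1 (Finset.Icc 2 M) := by
    ext k; simp only [Finset.mem_Icc, Finset.mem_insert]; omega
  have h1notin : (1 : ℕ) ∉ Finset.Icc 2 M := by simp
  rw [hsplit, Finset.sum_insert h1notin, ← Finset.sum_add_distrib]
  congr 1
  · simp
  · refine Finset.sum_congr rfl fun a ha => ?_
    rw [Finset.mem_Icc] at ha
    rw [← mul_add, Complex.cosh_add_sinh, natCast_cpow_eq_cexp (by omega)]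

/-- `P(−s) = y_1 + C − S`. [folklore] -/
theorem dirPoly_neg_eq (M : ℕ) (hM : 1 ≤ M) (y : ℕ → ℝ) (s : ℂ) :
    ∑ m ∈ Icc 1 M, ((y m : ℝ) : ℂ) * (m : ℂ) ^ (-s) = ((y 1 : ℝ) : ℂ) +
      ((∑ a ∈ Icc 2 M, ((y a : ℝ) : ℂ) * Complex.cosh (s * (Real.log (a : ℝ) : ℂ))) -
        ∑ a ∈ Icc 2 M, ((y a : ℝ) : ℂ) * Complex.sinh (s * (Real.log (a : ℝ) : ℂ))) := by
  have hsplit : Finset.Icc 1 M = insert 1 (Finset.Icc 2 M) := by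
    ext k; simp only [Finset.mem_Icc, Finset.mem_insert]; omega
  have h1notin : (1 : ℕ) ∉ Finset.Icc 2 M := by simp
  rw [hsplit, Finset.sum_insert h1notin, ← Finset.sum_sub_distrib]
  congr 1
  · simp
  · refine Finset.sum_congr rfl fun a ha => ?_
    rw [Finset.mem_Icc] at ha
    rw [← mul_sub, Complex.cosh_sub_sinh, natCast_cpow_eq_cexp (by omega), neg_mul]

/-- **The per-zero identity**: for `Σ_{m ≤ M} y_m = 0` and any `s`,
`Σ_{a,b ≥ 2} y_a y_b [cosh(sA) + cosh(sB) − cosh(s(A−B)) − 1] = −P(s)·P(−s)`. [folklore] -/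
theorem kernel_double_sum_eq_neg (M : ℕ) (hM : 1 ≤ M) (y : ℕ → ℝ)
    (hy0 : ∑ m ∈ Icc 1 M, y m = 0) (s : ℂ) :
    ∑ a ∈ Icc 2 M, ∑ b ∈ Icc 2 M, ((y a : ℝ) : ℂ) * ((y b : ℝ) : ℂ) *
        (Complex.cosh (s * (Real.log (a : ℝ) : ℂ)) + Complex.cosh (s * (Real.log (b : ℝ) : ℂ)) -
          Complex.cosh (s * (Real.log (a : ℝ) : ℂ) - s * (Real.log (b : ℝ) : ℂ)) - 1) =
      -((∑ m ∈ Icc 1 M, ((y m : ℝ) : ℂ) * (m : ℂ) ^ s) *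
          ∑ m ∈ Icc 1 M, ((y m : ℝ) : ℂ) * (m : ℂ) ^ (-s)) := by
  rw [kernel_double_sum, dirPoly_eq M hM y s, dirPoly_neg_eq M hM y s]
  have hsplit : Finset.Icc 1 M = insert 1 (Finset.Icc 2 M) := by
    ext k; simp only [Finset.mem_Icc, Finset.mem_insert]; omega
  have h1notin : (1 : ℕ) ∉ Finset.Icc 2 M := by simp
  have hy1 : ((y 1 : ℝ) : ℂ) = -∑ a ∈ Icc 2 M, ((y a : ℝ) : ℂ) := by
    have : y 1 + ∑ a ∈ Icc 2 M, y a = 0 := by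
      rw [hsplit, Finset.sum_insert h1notin] at hy0
      exact hy0
    have : y 1 = -∑ a ∈ Icc 2 M, y a := by linarith
    rw [this]
    push_cast
    rfl
  rw [hy1]
  ring

/-! ### The screw form as an absolutely convergent sum over the zeros -/

/-- The kernel entry `G(u, v) = Ψ(u) + Ψ(v) − Ψ(u − v)` as a sum over the zeros (Suzuki's series at
`u`, `v`, `u − v`). [folklore] -/
theorem hasSum_kernel (u v : ℝ) :
    HasSum (fun ρ : ZetaZeros.riemannZetaNontrivialZeros =>
      (riemannZetaZeroOrder (ρ : ℂ) : ℂ) *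
          ((Complex.cosh (((ρ : ℂ) - 1 / 2) * u) - 1) / ((ρ : ℂ) - 1 / 2) ^ 2) +
        (riemannZetaZeroOrder (ρ : ℂ) : ℂ) *
          ((Complex.cosh (((ρ : ℂ) - 1 / 2) * v) - 1) / ((ρ : ℂ) - 1 / 2) ^ 2) -
        (riemannZetaZeroOrder (ρ : ℂ) : ℂ) *
          ((Complex.cosh (((ρ : ℂ) - 1 / 2) * (u - v : ℝ)) - 1) / ((ρ : ℂ) - 1 / 2) ^ 2))
      (zetaScrewKernel u v : ℂ) := by
  have h : Suzuki2023_thm11_series := Suzuki2023_thm11_series_holds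
  have h' := ((h u).add (h v)).sub (h (u - v))
  rw [zetaScrewKernel_def]
  push_cast at h' ⊢
  exact h'

/-- **Unconditional zero expansion of the screw form** (Suzuki2023 Thm 1.1 (2) + the per-zero
identity). For `M ≥ 1` and a real vector `y` on `[1, M]` with `∑_{m ≤ M} y_m = 0`:
`∑_{2 ≤ m,m' ≤ M} G(log m, log m') y_m y_m' = ∑_ρ m(ρ) (−P_y(ρ−½)P_y(−(ρ−½)))/(ρ−½)²`,
`P_y(s) = ∑_{m ≤ M} y_m m^s`, as an absolutely convergent sum over the non-trivial zeros with
multiplicity. No hypothesis on the zeros. [folklore] -/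
theorem hasSum_screwForm (M : ℕ) (hM : 1 ≤ M) (y : ℕ → ℝ) (hy0 : ∑ m ∈ Icc 1 M, y m = 0) :
    HasSum (fun ρ : ZetaZeros.riemannZetaNontrivialZeros =>
      (riemannZetaZeroOrder (ρ : ℂ) : ℂ) *
        (-((∑ m ∈ Icc 1 M, ((y m : ℝ) : ℂ) * (m : ℂ) ^ ((ρ : ℂ) - 1 / 2)) *
            ∑ m ∈ Icc 1 M, ((y m : ℝ) : ℂ) * (m : ℂ) ^ (-((ρ : ℂ) - 1 / 2))) /
          ((ρ : ℂ) - 1 / 2) ^ 2))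
      ((∑ m ∈ Icc 2 M, ∑ m' ∈ Icc 2 M,
        zetaScrewKernel (Real.log m) (Real.log m') * (y m * y m') : ℝ) : ℂ) := by
  -- the raw expansion
  have hraw : HasSum (fun ρ : ZetaZeros.riemannZetaNontrivialZeros =>
      ∑ a ∈ Icc 2 M, ∑ b ∈ Icc 2 M, (((y a : ℝ) : ℂ) * ((y b : ℝ) : ℂ)) *
        ((riemannZetaZeroOrder (ρ : ℂ) : ℂ) *
            ((Complex.cosh (((ρ : ℂ) - 1 / 2) * (Real.log (a : ℝ))) - 1) / ((ρ : ℂ) - 1 / 2) ^ 2) +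
          (riemannZetaZeroOrder (ρ : ℂ) : ℂ) *
            ((Complex.cosh (((ρ : ℂ) - 1 / 2) * (Real.log (b : ℝ))) - 1) / ((ρ : ℂ) - 1 / 2) ^ 2) -
          (riemannZetaZeroOrder (ρ : ℂ) : ℂ) *
            ((Complex.cosh (((ρ : ℂ) - 1 / 2) * (Real.log (a : ℝ) - Real.log (b : ℝ) : ℝ)) - 1) /
              ((ρ : ℂ) - 1 / 2) ^ 2)))
      ((∑ m ∈ Icc 2 M, ∑ m' ∈ Icc 2 M,
        zetaScrewKernel (Real.log m) (Real.log m') * (y m * y m') : ℝ) : ℂ) := by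
    simp_rw [ofReal_sum, ofReal_mul]
    refine hasSum_sum fun a _ => hasSum_sum fun b _ => ?_
    have h := (hasSum_kernel (Real.log a) (Real.log b)).mul_left (((y a : ℝ) : ℂ) * ((y b : ℝ) : ℂ))
    have e : (zetaScrewKernel (Real.log a) (Real.log b) : ℂ) * ((y a : ℂ) * (y b : ℂ)) =
        ((y a : ℝ) : ℂ) * ((y b : ℝ) : ℂ) * (zetaScrewKernel (Real.log a) (Real.log b) : ℂ) := by ring
    rw [e]
    exact h
  -- rewrite each summand
  refine hraw.congr_fun fun ρ => ?_
  set s : ℂ := (ρ : ℂ) - 1 / 2 with hs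
  set μ : ℂ := (riemannZetaZeroOrder (ρ : ℂ) : ℂ) with hμ
  have hterm : ∀ a b : ℕ,
      (((y a : ℝ) : ℂ) * ((y b : ℝ) : ℂ)) *
          (μ * ((Complex.cosh (s * (Real.log (a : ℝ))) - 1) / s ^ 2) +
            μ * ((Complex.cosh (s * (Real.log (b : ℝ))) - 1) / s ^ 2) -
            μ * ((Complex.cosh (s * (Real.log (a : ℝ) - Real.log (b : ℝ) : ℝ)) - 1) / s ^ 2)) =
        μ / s ^ 2 * (((y a : ℝ) : ℂ) * ((y b : ℝ) : ℂ) *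
          (Complex.cosh (s * (Real.log (a : ℝ) : ℂ)) + Complex.cosh (s * (Real.log (b : ℝ) : ℂ)) -
            Complex.cosh (s * (Real.log (a : ℝ) : ℂ) - s * (Real.log (b : ℝ) : ℂ)) - 1)) := by
    intro a b
    push_cast
    rw [mul_sub s]
    ring
  rw [Finset.sum_congr rfl fun a _ => Finset.sum_congr rfl fun b _ => hterm a b]
  simp_rw [← Finset.mul_sum]
  rw [kernel_double_sum_eq_neg M hM y hy0 s]
  ring

end Summit.RiemannHypothesis.RiemannHypothesis.Theorems.IntegerScrewLandau

end
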